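import Literature.ModelTheory.ExponentialFields.DefinablyCompleteCalculus
import Literature.ModelTheory.ExponentialFields.ClosedTermTransfer
import HarnessLib

/-!
# The exponential of a definably complete ordered exponential field is determined by its axioms

Topic `Literature/ModelTheory/ExponentialFields`.  In every ordered field `K`, a map `E` with
`E(x + y) = E(x)E(y)` and `x + 1 ≤ E(x)` (`IsOrderedExp`, `ClosedTermTransfer.lean` — the two
exponential axioms of the finite true theory `OEF`, `OrderedExpFieldModels.lean`) is
differentiable in the order topology with `E' = E` (`IsOrderedExp.hasFieldDerivAt`; the
difference quotient `(E h - 1)/h` is squeezed between `1` and `(1 - h)⁻¹`).  If moreover `K`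
carries a definably complete structure in which `<`, `+`, `*` are definable, then **two such
maps with definable graphs coincide** (`IsOrderedExp.eq_of_isDefinablyComplete`): the quotient
`E₁(x)E₂(-x)` has derivative `0`, hence is constant by the mean value theorem of
`DefinablyCompleteCalculus.lean`.  This is the remark of Berarducci–Servi, *An effective version
of Wilkie's theorem of the complement*, Ann. Pure Appl. Logic 125 (2004), §2 (after Thm. 2.7):
"In any model `M` of the proposed axioms, any other definable function satisfying EXP must
coincide with the interpretation of `eˣ` in `M`" — there for o-minimal models via a uniqueness
theorem for ODEs, here for the definably complete models of `OEF ∪ [DC]`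
(`exists_recursive_subtheory_definablyComplete`, `DefinableCompletenessCodes.lean`) via the
definable mean value theorem.  Everything is proved; nothing here is a named fact.

## References

* A. Berarducci, T. Servi, *An effective version of Wilkie's theorem of the complement and some
  effective o-minimality results*, Ann. Pure Appl. Logic 125 (2004), §2. [BerarducciServi2004]
* C. Miller, *Expansions of dense linear orders with the intermediate value property*,
  J. Symbolic Logic 66 (2001). [Miller2001]
-/

open Set FirstOrder FirstOrder.Language
open _root_.Filter _root_.Topology

namespace Literature.ModelTheory.ExponentialFields

universe u v

/-! ### Differentiable functions are continuous -/

section Cont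

variable {K : Type*} [Field K] [TopologicalSpace K] [IsTopologicalRing K]

/-- A function with a field derivative at `x` is continuous at `x`
(`f y = f x + slope · (y - x)`). [folklore] -/
theorem HasFieldDerivAt.continuousAt {f : K → K} {f' x : K} (hf : HasFieldDerivAt f f' x) :
    ContinuousAt f x := by
  rw [hasFieldDerivAt_iff] at hf
  have hsub : Tendsto (fun y => y - x) (𝓝[≠] x) (𝓝 0) := by
    have : Tendsto (fun y => y - x) (𝓝 x) (𝓝 (x - x)) := tendsto_id.sub tendsto_const_nhds
    rw [sub_self] at this
    exact this.mono_left nhdsWithin_le_nhds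
  have hprod : Tendsto (fun y => (f y - f x) / (y - x) * (y - x) + f x) (𝓝[≠] x) (𝓝 (f x)) := by
    have := (hf.mul hsub).add (tendsto_const_nhds (x := f x))
    simpa using this
  have hwithin : Tendsto f (𝓝[≠] x) (𝓝 (f x)) := by
    refine hprod.congr' (eventually_nhdsWithin_of_forall fun y hy => ?_)
    have hyx : y - x ≠ 0 := sub_ne_zero.2 hy
    field_simp
    ring
  exact continuousWithinAt_compl_self.1 hwithin

end Cont

/-! ### An ordered exponential is differentiable with `E' = E` -/

section OrderedExp

variable {K : Type*} [Field K] [LinearOrder K] [IsStrictOrderedRing K]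

namespace IsOrderedExp

variable {E : K → K} (hE : IsOrderedExp E)
include hE

/-- `E(h) ≤ (1 - h)⁻¹` for `h < 1` (from `E(-h) ≥ 1 - h > 0`). [folklore] -/
theorem le_inv_one_sub {h : K} (hh : h < 1) : E h ≤ (1 - h)⁻¹ := by
  have := hE.le_inv_one_sub_div_pow (m := 1) Nat.one_pos (x := h) (by simpa using hh)
  simpa using this

/-- **Two-sided bound for the difference quotient at `0`**: for `h ≠ 0`, `h < 1`, the quotient
`(E h - 1)/h` lies between `1` and `(1 - h)⁻¹`. [folklore] -/
theorem min_le_slope_zero {h : K} (h0 : h ≠ 0) (hh : h < 1) :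
    min 1 (1 - h)⁻¹ ≤ (E h - 1) / h ∧ (E h - 1) / h ≤ max 1 (1 - h)⁻¹ := by
  have h1 : h ≤ E h - 1 := by linarith [hE.add_one_le h]
  have h1h : 0 < 1 - h := by linarith
  have h2 : E h - 1 ≤ h / (1 - h) := by
    have := hE.le_inv_one_sub hh
    rw [inv_eq_one_div] at this
    have key : E h - 1 ≤ 1 / (1 - h) - 1 := by linarith
    calc E h - 1 ≤ 1 / (1 - h) - 1 := key
      _ = h / (1 - h) := by field_simp; ring
  rcases lt_or_gt_of_ne h0 with hneg | hpos
  · -- `h < 0`: dividing by `h` reverses the inequalities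
    have hA : (E h - 1) / h ≤ 1 := by
      rw [div_le_iff_of_neg hneg, one_mul]; exact h1
    have hB : (1 - h)⁻¹ ≤ (E h - 1) / h := by
      rw [le_div_iff_of_neg hneg]
      calc E h - 1 ≤ h / (1 - h) := h2
        _ = (1 - h)⁻¹ * h := by rw [div_eq_inv_mul]
    exact ⟨(min_le_right _ _).trans hB, hA.trans (le_max_left _ _)⟩
  · have hA : 1 ≤ (E h - 1) / h := by
      rw [le_div_iff₀ hpos, one_mul]; exact h1
    have hB : (E h - 1) / h ≤ (1 - h)⁻¹ := by
      rw [div_le_iff₀ hpos]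
      calc E h - 1 ≤ h / (1 - h) := h2
        _ = (1 - h)⁻¹ * h := by rw [div_eq_inv_mul]
    exact ⟨(min_le_left _ _).trans hA, hB.trans (le_max_right _ _)⟩

variable [TopologicalSpace K] [OrderTopology K]

/-- **The difference quotient of `E` at `0` tends to `1`** (squeeze between `1` and
`(1 - h)⁻¹ → 1`). [folklore] -/
theorem tendsto_slope_zero : Tendsto (fun h => (E h - 1) / h) (𝓝[≠] (0 : K)) (𝓝 1) := by
  have hinv : Tendsto (fun h : K => (1 - h)⁻¹) (𝓝 0) (𝓝 1) := by
    have h1 : Tendsto (fun h : K => 1 - h) (𝓝 0) (𝓝 (1 - 0)) := tendsto_const_nhds.sub tendsto_id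
    rw [sub_zero] at h1
    simpa using h1.inv₀ one_ne_zero
  have hlow : Tendsto (fun h : K => min 1 (1 - h)⁻¹) (𝓝[≠] 0) (𝓝 1) := by
    have := (tendsto_const_nhds (x := (1 : K))).min hinv
    rw [min_self] at this
    exact this.mono_left nhdsWithin_le_nhds
  have hup : Tendsto (fun h : K => max 1 (1 - h)⁻¹) (𝓝[≠] 0) (𝓝 1) := by
    have := (tendsto_const_nhds (x := (1 : K))).max hinv
    rw [max_self] at this
    exact this.mono_left nhdsWithin_le_nhds
  have hev : ∀ᶠ h in 𝓝[≠] (0 : K), h ≠ 0 ∧ h < 1 := by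
    filter_upwards [self_mem_nhdsWithin, mem_nhdsWithin_of_mem_nhds (Iio_mem_nhds one_pos)]
      with h h0 h1
    exact ⟨h0, h1⟩
  refine tendsto_of_tendsto_of_tendsto_of_le_of_le' hlow hup ?_ ?_
  · filter_upwards [hev] with h hh; exact (hE.min_le_slope_zero hh.1 hh.2).1
  · filter_upwards [hev] with h hh; exact (hE.min_le_slope_zero hh.1 hh.2).2

/-- **An ordered exponential is differentiable with `E' = E`**: in every ordered field with its
order topology, `E(x + y) = E(x)E(y)` and `x + 1 ≤ E(x)` give `HasFieldDerivAt E (E x) x`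
(the slope at `x` is `E x · (E(y - x) - 1)/(y - x)`). [folklore] -/
theorem hasFieldDerivAt (x : K) : HasFieldDerivAt E (E x) x := by
  rw [hasFieldDerivAt_iff]
  have hshift : Tendsto (fun y => y - x) (𝓝[≠] x) (𝓝[≠] 0) := by
    refine tendsto_nhdsWithin_of_tendsto_nhds_of_eventually_within _ ?_ ?_
    · have : Tendsto (fun y => y - x) (𝓝 x) (𝓝 (x - x)) := tendsto_id.sub tendsto_const_nhds
      rw [sub_self] at this
      exact this.mono_left nhdsWithin_le_nhds
    · exact eventually_nhdsWithin_of_forall fun y hy => sub_ne_zero.2 hy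
  have h := (hE.tendsto_slope_zero.comp hshift).const_mul (E x)
  rw [mul_one] at h
  refine h.congr' (eventually_nhdsWithin_of_forall fun y hy => ?_)
  have hyx : y - x ≠ 0 := sub_ne_zero.2 hy
  have hEy : E y = E x * E (y - x) := by rw [← hE.map_add, add_sub_cancel]
  simp only [Function.comp_apply, hEy]
  field_simp

/-- An ordered exponential is continuous. [folklore] -/
theorem continuous : Continuous E :=
  continuous_iff_continuousAt.2 fun x => (hE.hasFieldDerivAt x).continuousAt

end IsOrderedExp

end OrderedExp

/-! ### Two definable ordered exponentials of a definably complete ordered field coincide -/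

section Unique

variable {K : Type*} [Field K] [LinearOrder K] [IsStrictOrderedRing K] [TopologicalSpace K]
  [OrderTopology K] {L : FirstOrder.Language.{u, v}} [L.Structure K]

omit [TopologicalSpace K] [OrderTopology K] in
/-- The quotient `q(x) = E₁(x) · E₂(-x)` of two ordered exponentials satisfies
`1 - h² ≤ q(h)` and `q(h) · (1 - h²) ≤ 1` for `-1 < h < 1`. [folklore] -/
theorem IsOrderedExp.quotient_bounds {E₁ E₂ : K → K} (h₁ : IsOrderedExp E₁) (h₂ : IsOrderedExp E₂)
    {h : K} (hlo : -1 < h) (hhi : h < 1) :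
    1 - h ^ 2 ≤ E₁ h * E₂ (-h) ∧ E₁ h * E₂ (-h) * (1 - h ^ 2) ≤ 1 := by
  have a₁ : 1 + h ≤ E₁ h := by linarith [h₁.add_one_le h]
  have a₂ : 1 - h ≤ E₂ (-h) := by linarith [h₂.add_one_le (-h)]
  have b₁ : E₁ h ≤ (1 - h)⁻¹ := h₁.le_inv_one_sub hhi
  have b₂ : E₂ (-h) ≤ (1 + h)⁻¹ := by
    have := h₂.le_inv_one_sub (h := -h) (by linarith)
    simpa [sub_neg_eq_add] using this
  have p₁ : 0 < 1 + h := by linarith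
  have p₂ : 0 < 1 - h := by linarith
  constructor
  · calc 1 - h ^ 2 = (1 + h) * (1 - h) := by ring
      _ ≤ E₁ h * E₂ (-h) := mul_le_mul a₁ a₂ p₂.le (h₁.pos h).le
  · have hprod : E₁ h * E₂ (-h) ≤ (1 - h)⁻¹ * (1 + h)⁻¹ :=
      mul_le_mul b₁ b₂ (h₂.pos _).le (inv_nonneg.2 p₂.le)
    calc E₁ h * E₂ (-h) * (1 - h ^ 2) ≤ (1 - h)⁻¹ * (1 + h)⁻¹ * (1 - h ^ 2) :=
          mul_le_mul_of_nonneg_right hprod (by nlinarith)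
      _ = 1 := by field_simp; ring

/-- The quotient `q(x) = E₁(x)E₂(-x)` of two ordered exponentials has derivative `0` everywhere
(its difference quotient at `0` is squeezed by `∓ h / (1 - h²)`-type bounds, and
`q(x + h) = q(x) q(h)`). [folklore] -/
theorem IsOrderedExp.hasFieldDerivAt_quotient_zero {E₁ E₂ : K → K} (h₁ : IsOrderedExp E₁)
    (h₂ : IsOrderedExp E₂) (x : K) :
    HasFieldDerivAt (fun y => E₁ y * E₂ (-y)) 0 x := by
  set q : K → K := fun y => E₁ y * E₂ (-y) with hq
  have hqmul : ∀ a b, q (a + b) = q a * q b := fun a b => by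
    simp only [hq, neg_add, h₁.map_add, h₂.map_add]; ring
  have hq0 : q 0 = 1 := by simp [hq, h₁.map_zero, h₂.map_zero]
  -- the difference quotient at `0` tends to `0`
  have hslope0 : Tendsto (fun h => (q h - 1) / h) (𝓝[≠] (0 : K)) (𝓝 0) := by
    have hden : Tendsto (fun h : K => h / (1 - h ^ 2)) (𝓝 0) (𝓝 0) := by
      have h1 : Tendsto (fun h : K => 1 - h ^ 2) (𝓝 0) (𝓝 (1 - 0 ^ 2)) :=
        tendsto_const_nhds.sub (tendsto_id.pow 2)
      have : Tendsto (fun h : K => h / (1 - h ^ 2)) (𝓝 0) (𝓝 (0 / (1 - 0 ^ 2))) :=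
        tendsto_id.div h1 (by norm_num)
      simpa using this
    have hlow : Tendsto (fun h : K => (h / (1 - h ^ 2)) ⊓ -h) (𝓝[≠] 0) (𝓝 0) := by
      have := (hden.min tendsto_id.neg)
      simp only [neg_zero, min_self] at this
      exact this.mono_left nhdsWithin_le_nhds
    have hup : Tendsto (fun h : K => -h ⊔ h / (1 - h ^ 2)) (𝓝[≠] 0) (𝓝 0) := by
      have := (tendsto_id.neg.max hden)
      simp only [neg_zero, max_self] at this
      exact this.mono_left nhdsWithin_le_nhds
    have hev : ∀ᶠ h in 𝓝[≠] (0 : K), h ≠ 0 ∧ -1 < h ∧ h < 1 := by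
      filter_upwards [self_mem_nhdsWithin,
        mem_nhdsWithin_of_mem_nhds (Ioo_mem_nhds (neg_one_lt_zero : (-1 : K) < 0) one_pos)]
        with h h0 hI
      exact ⟨h0, hI.1, hI.2⟩
    have hbounds : ∀ h : K, h ≠ 0 → -1 < h → h < 1 →
        -h ^ 2 ≤ q h - 1 ∧ q h - 1 ≤ h ^ 2 / (1 - h ^ 2) := by
      intro h h0 hlo hhi
      obtain ⟨hb1, hb2⟩ := h₁.quotient_bounds h₂ hlo hhi
      have hpos : 0 < 1 - h ^ 2 := by nlinarith
      refine ⟨by simp only [hq]; linarith, ?_⟩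
      rw [le_div_iff₀ hpos]; simp only [hq]; nlinarith
    refine tendsto_of_tendsto_of_tendsto_of_le_of_le' hlow hup ?_ ?_
    · filter_upwards [hev] with h hh
      obtain ⟨hge, hle⟩ := hbounds h hh.1 hh.2.1 hh.2.2
      rcases lt_or_gt_of_ne hh.1 with hneg | hposh
      · have : h / (1 - h ^ 2) ≤ (q h - 1) / h := by
          rw [le_div_iff_of_neg hneg]
          calc q h - 1 ≤ h ^ 2 / (1 - h ^ 2) := hle
            _ = h / (1 - h ^ 2) * h := by ring
        exact (min_le_left _ _).trans this
      · have : -h ≤ (q h - 1) / h := by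
          rw [le_div_iff₀ hposh]
          calc -h * h = -h ^ 2 := by ring
            _ ≤ q h - 1 := hge
        exact (min_le_right _ _).trans this
    · filter_upwards [hev] with h hh
      obtain ⟨hge, hle⟩ := hbounds h hh.1 hh.2.1 hh.2.2
      rcases lt_or_gt_of_ne hh.1 with hneg | hposh
      · have : (q h - 1) / h ≤ -h := by
          rw [div_le_iff_of_neg hneg]
          calc -h * h = -h ^ 2 := by ring
            _ ≤ q h - 1 := hge
        exact this.trans (le_max_left _ _)
      · have : (q h - 1) / h ≤ h / (1 - h ^ 2) := by
          rw [div_le_iff₀ hposh]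
          calc q h - 1 ≤ h ^ 2 / (1 - h ^ 2) := hle
            _ = h / (1 - h ^ 2) * h := by ring
        exact this.trans (le_max_right _ _)
  -- translate to `x`
  rw [hasFieldDerivAt_iff]
  have hshift : Tendsto (fun y => y - x) (𝓝[≠] x) (𝓝[≠] 0) := by
    refine tendsto_nhdsWithin_of_tendsto_nhds_of_eventually_within _ ?_ ?_
    · have : Tendsto (fun y => y - x) (𝓝 x) (𝓝 (x - x)) := tendsto_id.sub tendsto_const_nhds
      rw [sub_self] at this
      exact this.mono_left nhdsWithin_le_nhds
    · exact eventually_nhdsWithin_of_forall fun y hy => sub_ne_zero.2 hy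
  have h := (hslope0.comp hshift).const_mul (q x)
  rw [mul_zero] at h
  refine h.congr' (eventually_nhdsWithin_of_forall fun y hy => ?_)
  have hyx : y - x ≠ 0 := sub_ne_zero.2 hy
  have hqy : q y = q x * q (y - x) := by rw [← hqmul, add_sub_cancel]
  show q x * ((q (y - x) - 1) / (y - x)) = (q y - q x) / (y - x)
  rw [hqy]
  field_simp

omit [TopologicalSpace K] [OrderTopology K] in
/-- The graph of the quotient `E₁(x)E₂(-x)` is definable when those of `E₁`, `E₂`, `+`, `*`
are. [folklore] -/
theorem definable_graph_quotient {E₁ E₂ : K → K}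
    (hadd : (univ : Set K).Definable L {v : Fin 3 → K | v 2 = v 0 + v 1})
    (hmul : (univ : Set K).Definable L {v : Fin 3 → K | v 2 = v 0 * v 1})
    (hE₁ : (univ : Set K).Definable L {v : Fin 2 → K | v 1 = E₁ (v 0)})
    (hE₂ : (univ : Set K).Definable L {v : Fin 2 → K | v 1 = E₂ (v 0)}) :
    (univ : Set K).Definable L {v : Fin 2 → K | v 1 = E₁ (v 0) * E₂ (-(v 0))} := by
  have hid : (univ : Set K).Definable L {v : Fin 2 → K | v 1 = (fun x => x) (v 0)} :=
    definable_setOf_eq_params (definableFun_proj_params 1) (definableFun_proj_params 0)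
  have hneg : (univ : Set K).DefinableFun L (fun v : Fin 2 → K => -(v 0)) :=
    definableFun_apply_params (by simpa using definable_graph_neg (f := fun x => x) hadd hid)
      (definableFun_proj_params 0)
  have hF : (univ : Set K).DefinableFun L (fun v : Fin 2 → K => E₁ (v 0) * E₂ (-(v 0))) :=
    definableFun_apply₂_params hmul (definableFun_apply_params hE₁ (definableFun_proj_params 0))
      (definableFun_apply_params hE₂ hneg)
  have h := definable_setOf_eq_params (definableFun_proj_params (1 : Fin 2)) hF
  simpa using h

/-- **Uniqueness of the exponential in a definably complete ordered field** (Berarducci–Servi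
2004, §2, the remark after Thm. 2.7: "any other definable function satisfying EXP must coincide
with the interpretation of `eˣ`", there for o-minimal models; here for definably complete
ones): if `K` carries a definably complete structure in which `<`, `+`, `*` are definable, two
maps `E₁, E₂` with `Eᵢ(x + y) = Eᵢ(x)Eᵢ(y)`, `x + 1 ≤ Eᵢ(x)` and definable graphs are equal.
(The definable quotient `E₁(x)E₂(-x)` has derivative `0`, hence is constant by the definable
mean value theorem, and equals `1` at `0`.) [cite: BerarducciServi2004, §2] -/
theorem IsOrderedExp.eq_of_isDefinablyComplete {E₁ E₂ : K → K} (h₁ : IsOrderedExp E₁)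
    (h₂ : IsOrderedExp E₂) (hDC : L.IsDefinablyComplete K)
    (hlt : (univ : Set K).Definable L {v : Fin 2 → K | v 0 < v 1})
    (hadd : (univ : Set K).Definable L {v : Fin 3 → K | v 2 = v 0 + v 1})
    (hmul : (univ : Set K).Definable L {v : Fin 3 → K | v 2 = v 0 * v 1})
    (hE₁ : (univ : Set K).Definable L {v : Fin 2 → K | v 1 = E₁ (v 0)})
    (hE₂ : (univ : Set K).Definable L {v : Fin 2 → K | v 1 = E₂ (v 0)}) : E₁ = E₂ := by
  set q : K → K := fun y => E₁ y * E₂ (-y) with hq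
  have hder : ∀ x, HasFieldDerivAt q 0 x := h₁.hasFieldDerivAt_quotient_zero h₂
  have hcont : Continuous q := continuous_iff_continuousAt.2 fun x => (hder x).continuousAt
  have hqdef := definable_graph_quotient hadd hmul hE₁ hE₂
  have hq0 : q 0 = 1 := by simp [hq, h₁.map_zero, h₂.map_zero]
  -- `q` is constant equal to `1`
  have hq1 : ∀ x, q x = 1 := by
    intro x
    rcases lt_trichotomy x 0 with hx | rfl | hx
    · have := hDC.eq_of_hasFieldDerivAt_eq_zero hlt hadd hmul hqdef hx hcont.continuousOn
        (fun y _ => hder y)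
      rw [← hq0, ← this]
    · exact hq0
    · have := hDC.eq_of_hasFieldDerivAt_eq_zero hlt hadd hmul hqdef hx hcont.continuousOn
        (fun y _ => hder y)
      rw [this, hq0]
  funext x
  have hx := hq1 x
  simp only [hq] at hx
  -- `E₁ x · E₂(-x) = 1` and `E₂ x · E₂(-x) = 1`
  have h2 := h₂.mul_map_neg x
  have hne : E₂ (-x) ≠ 0 := (h₂.pos _).ne'
  exact mul_right_cancel₀ hne (hx.trans h2.symm)

end Unique

end Literature.ModelTheory.ExponentialFields
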